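import Literature.MathematicalPhysics.QuantumFieldTheory.BalabanImbrieJaffe1984to88.BIJ88Eq5145CornerModel
import Literature.MathematicalPhysics.QuantumFieldTheory.BalabanImbrieJaffe1984to88.BIJ88CumulantAllOrders5133
import Literature.MathematicalPhysics.QuantumFieldTheory.BalabanImbrieJaffe1984to88.BIJ88CornerSumLastCube309

/-!
# `BalabanImbrieJaffe1984to88.BIJ88RegionLawUniv309` — T. Bałaban, J. Imbrie, A. Jaffe, *Effective action and cluster properties of the abelian
Higgs model*, Commun. Math. Phys. **114** (1988) 257–315 [BalabanImbrieJaffe1988], Sect. 5.13 p. 305–306 [PDF 49–50] with Sect. 5.14 (5.14.3)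
p. 309 [PDF 53]: **THE BRIDGE BETWEEN THE REGION LAWS OF THE (5.14.x) LINEAGE AND THE INTERPOLATED EXPECTATIONS OF THE (5.13.3) ENGINE, ON
THE FULL REGION** — p. 306: *"⟨·⟩_{s_Γ,X} is defined by integrating over the fields in X only"*; when `X` is the set of ALL cubes the fields of
`X` are all the fields, and the region expectation `⟨·⟩_{s,X}` of p25's `BIJ88PolymerRep5134Gauss` (over `Site blk X → ℝ`) IS the interpolated
expectation `⟨·⟩_s` of p13's `BIJ88PairingDisplay305` (over `α → ℝ`) after relabelling the coordinates — so the `s`-derivatives, truncations and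
train forms of p13's engine (`BIJ88CumulantAllOrders5133.dexp`, `hasDerivAt_dexp`, `BIJ88WalkFormOrderOne5133.dexp_singleton_walk`) apply to the
corner expectations `z X Λ` and the region laws `law(X, 1_Λ)` in which p36's (5.14.3)–(5.14.5) files are written.  Capstone (§3): the LAST-CUBE
BOUND for the corner sums of the full-region expectations — `|cornerSum (z univ ·) Γ| ≤ 2^{|Γ|−1} · sup_{s∈[0,1]^I} |∂{n}⟨Π f⟩(s)|` (`n ∈ Γ`) —
p36 g18's `BIJ88CornerSumLastCube309` fed with p13's `hasDerivAt_dexp`.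

statement-level skeleton of published theorems with citation tags; proofs where landed; nothing here is a claim about the Yang–Mills mass gap

PDF held: `paper:balaban1988-cmp114-bij-abelian-higgs-effective-action` (journal page = PDF page + 256); p. 305 (p0049.txt L19–23), verbatim:
*"To give our expansion, we use the fundamental theorem of calculus … ⟨·⟩_{s_Γ} is the expectation with quadratic form Δ_{s_Γ} instead of
Δ."*; p. 306, verbatim: *"Here s = {s_i : □_i ⊂ X}, and ⟨·⟩_{s_Γ,X} is defined by integrating over the fields in X only."*

WHAT IS PROVED (unit `lit-balaban-p36`, generation 18 of the Phase-2 proof seat p36; SKELETON rows C2.Eq5.13.3-5.13.4 / C2.Eq5.14.3-5.14.4 of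
`HOME/lit-balaban-r16/ROWS-C2-part2.md`, owner r16 — identities and one abstract bound, no (5.14.4) estimate, no head change; successor
infrastructure per HOME/HANDOFF.md p36 gen 18).
* §1 relabelling along `Site blk univ ≃ α` (p25's `integral_transport`): `integral_site_univ`, `weight_prec_univ`, `source_src_univ`, `ext_univ`.
* §2 **`integral_regionLaw_univ`** — `∫ g d law(univ, 1_Λ) = ⟨g ∘ restrict⟩_{1_Λ}` (p13's `expect`); **`expect_univ_eq`** — p25's
  `expect univ s = ⟨Π_i f_i⟩_s` for EVERY `s`; `zG_univ_eq`.
* §3 **`hasDerivAt_zG_univ_update`** (the `s_n`-derivative of the full-region expectation along a coordinate line is p13's `dexp {n}`) and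
  **`abs_cornerSum_zG_univ_le`** — the last-cube bound displayed above, for cube-local bounded measurable `Π f` (`Δ ≻ 0` with form bounds).
HONEST SCOPE: the full region `X = univ` only (a proper region `X` needs the marginal precision, not done here); 0 `sorry`, 0 definitions,
0 `Prop` facts (D-0026); imports `BIJ88Eq5145CornerModel` (p25/p36 lineage), `BIJ88CumulantAllOrders5133` (p13), `BIJ88CornerSumLastCube309`
(p36 g18); modifies nothing.  NOT summit progress; NOT continuum; NOT Clay.  Cell `lit-balaban` Phase 2, seat p36 gen 18 (owner r16, referee ref-5).
-/

noncomputable section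

open Finset MeasureTheory Matrix Function Filter
open Literature.MathematicalPhysics.QuantumFieldTheory.Balaban1983to89
open B2Eq228Conditioning (weight source)
open Literature.MathematicalPhysics.QuantumFieldTheory.BalabanImbrieJaffe1984to88
open BIJ88DirichletForms305 (interpForm)
open BIJ88Clusters5134 (cornerSum)
open BIJ88PolymerRep5134 (corner corner_apply)
open BIJ88PolymerRep5134Gauss (obs prec src zG integral_transport quadForm_transport)
open BIJ88SlotMomentsGauss308 (fieldLaw integral_fieldLaw)
open BIJ88Eq5145CornerModel (regionLaw prec_interp_corner)
open BIJ88CumulantAllOrders5133 (dexp dexp_empty hasDerivAt_dexp)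
open BIJ88CornerSumLastCube309 (abs_cornerSum_corner_le_of_hasDerivAt_of_forall)

namespace Literature.MathematicalPhysics.QuantumFieldTheory.BalabanImbrieJaffe1984to88.BIJ88RegionLawUniv309

variable {α I : Type} [Fintype α] [DecidableEq α] [Fintype I] [DecidableEq I] (blk : α → I) (Δ : Matrix α α ℝ) (ℱ : α → ℝ)

/-! ## §1 Relabelling the fields of all cubes -/
section Relabel

omit [DecidableEq α] in
/-- an integral over the fields of all cubes is an integral over all fields (relabelling `Site blk univ ≃ α`, Lebesgue measure preserved).
[cite: BalabanImbrieJaffe1988, p.306 (Sect. 5.13)] -/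
theorem integral_site_univ (g : (BIJ88PolymerRep5134Gauss.Site blk (univ : Finset I) → ℝ) → ℝ) :
    ∫ φ : BIJ88PolymerRep5134Gauss.Site blk (univ : Finset I) → ℝ, g φ = ∫ ψ : α → ℝ, g (fun x => ψ x.1) := by
  have h := integral_transport (Equiv.subtypeUnivEquiv (fun x : α => mem_univ (blk x))).symm g
  simpa using h

/-- the Gaussian weight of the full-region precision is the weight of `Δ_s`. [cite: BalabanImbrieJaffe1988, p.306 (Sect. 5.13)] -/
theorem weight_prec_univ (s : I → ℝ) (ψ : α → ℝ) :
    weight (prec blk Δ (univ : Finset I) s) (fun x : BIJ88PolymerRep5134Gauss.Site blk (univ : Finset I) => ψ x.1) = weight (interpForm blk Δ s) ψ := by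
  have h := quadForm_transport (Equiv.subtypeUnivEquiv (fun x : α => mem_univ (blk x))) (interpForm blk Δ s)
    (fun x : BIJ88PolymerRep5134Gauss.Site blk (univ : Finset I) => ψ x.1)
  simp only [Equiv.subtypeUnivEquiv_symm_apply] at h
  have hval : prec blk Δ (univ : Finset I) s = (interpForm blk Δ s).submatrix (Equiv.subtypeUnivEquiv (fun x : α => mem_univ (blk x)))
      (Equiv.subtypeUnivEquiv (fun x : α => mem_univ (blk x))) := rfl
  rw [weight, weight, hval, ← h]

omit [DecidableEq α] in
/-- the linear source of the full region is the source of `ℱ`. [cite: BalabanImbrieJaffe1988, p.306 (Sect. 5.13)] -/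
theorem source_src_univ (ψ : α → ℝ) :
    source (src blk ℱ (univ : Finset I)) (fun x : BIJ88PolymerRep5134Gauss.Site blk (univ : Finset I) => ψ x.1) = source ℱ ψ := by
  rw [source, source]
  congr 1
  exact (Equiv.subtypeUnivEquiv (fun x : α => mem_univ (blk x))).sum_comp (fun a => ℱ a * ψ a)

omit [Fintype α] [DecidableEq α] in
/-- extension by zero off the full region is the identity. [cite: BalabanImbrieJaffe1988, p.306 (Sect. 5.13)] -/
theorem ext_univ (ψ : α → ℝ) : BIJ88PolymerRep5134Gauss.ext blk (univ : Finset I) (fun x : BIJ88PolymerRep5134Gauss.Site blk (univ : Finset I) => ψ x.1) = ψ := by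
  funext x
  simp [BIJ88PolymerRep5134Gauss.ext]

end Relabel

/-! ## §2 Region laws and corner expectations on the full region are p13's interpolated expectations -/
section Bridge

/-- **`∫ g d law(univ, 1_Λ) = ⟨g ∘ restrict⟩_{1_Λ}`**: the law of the fields of ALL cubes at the corner `1_Λ` integrates `g` to p13's interpolated
expectation of `ψ ↦ g(ψ|_sites)` at `s = 1_Λ`. [cite: BalabanImbrieJaffe1988, p.306 (Sect. 5.13); (5.14.3) p.309] -/
theorem integral_regionLaw_univ (g : (BIJ88PolymerRep5134Gauss.Site blk (univ : Finset I) → ℝ) → ℝ) (Λ : Finset I) :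
    ∫ φ, g φ ∂(regionLaw blk Δ ℱ (univ : Finset I) Λ) =
      BIJ88PairingDisplay305.expect blk Δ ℱ (fun ψ => g (fun x => ψ x.1)) (corner ℝ Λ) := by
  rw [regionLaw, integral_fieldLaw, prec_interp_corner, BIJ88PairingDisplay305.expect, integral_site_univ, integral_site_univ]
  simp only [weight_prec_univ, source_src_univ]

/-- **p25's region expectation on the full region is p13's interpolated expectation, for every `s`**: `⟨Π_{i} f(□_i)⟩_{s,univ} = ⟨Π_i f_i⟩_s`.
[cite: BalabanImbrieJaffe1988, p.306 (Sect. 5.13)] -/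
theorem expect_univ_eq (f : I → (α → ℝ) → ℝ) (s : I → ℝ) :
    BIJ88PolymerRep5134Gauss.expect blk Δ ℱ f (univ : Finset I) s = BIJ88PairingDisplay305.expect blk Δ ℱ (fun ψ => ∏ i, f i ψ) s := by
  rw [BIJ88PolymerRep5134Gauss.expect, BIJ88PairingDisplay305.expect, integral_site_univ, integral_site_univ]
  simp only [weight_prec_univ, source_src_univ, obs, ext_univ]

/-- the corner expectations of the full region: `z univ Λ = ⟨Π_i f_i⟩_{1_Λ}`. [cite: BalabanImbrieJaffe1988, p.306 (Sect. 5.13)] -/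
theorem zG_univ_eq (f : I → (α → ℝ) → ℝ) (Λ : Finset I) :
    zG blk Δ ℱ f (univ : Finset I) Λ = BIJ88PairingDisplay305.expect blk Δ ℱ (fun ψ => ∏ i, f i ψ) (corner ℝ Λ) := by
  rw [zG, expect_univ_eq]

end Bridge

/-! ## §3 The last-cube bound for the full-region corner expectations -/
section LastCube

variable {Δ} (hΔ : Δ.PosDef) {c C : ℝ} (hc : 0 < c) (hcΔ : ∀ v, c * (v ⬝ᵥ v) ≤ v ⬝ᵥ (Δ *ᵥ v)) (hCΔ : ∀ v, v ⬝ᵥ (Δ *ᵥ v) ≤ C * (v ⬝ᵥ v))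
  {f : I → (α → ℝ) → ℝ} (hfm : AEStronglyMeasurable (fun ψ : α → ℝ => ∏ i, f i ψ) volume) {K₀ : ℝ} (hK : ∀ ψ : α → ℝ, ‖∏ i, f i ψ‖ ≤ K₀)

include hΔ hc hcΔ hCΔ hfm hK in
/-- **the `s_n`-derivative of the full-region expectation along a coordinate line is p13's `∂{n}⟨Π f⟩`** (`hasDerivAt_dexp` at `Γ = ∅` through
`expect_univ_eq`). [cite: BalabanImbrieJaffe1988, (5.13.3) p.305; p.306 (Sect. 5.13)] -/
theorem hasDerivAt_zG_univ_update {s : I → ℝ} (hs : ∀ l, 0 ≤ s l ∧ s l ≤ 1) (n : I) :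
    HasDerivAt (fun u => BIJ88PolymerRep5134Gauss.expect blk Δ ℱ f (univ : Finset I) (update s n u))
      (dexp blk Δ ℱ (fun ψ => ∏ i, f i ψ) {n} s) (s n) := by
  have h := hasDerivAt_dexp blk hΔ hc hcΔ hCΔ hs n ℱ hfm hK (Γ := ∅) (Finset.notMem_empty n)
  simp only [dexp_empty, Finset.insert_empty] at h
  simp only [expect_univ_eq]
  exact h

include hΔ hc hcΔ hCΔ hfm hK in
/-- **THE LAST-CUBE BOUND FOR THE FULL-REGION CORNER EXPECTATIONS**: for `n ∈ Γ` and a bound `B` on p13's first `s_n`-derivative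
`∂{n}⟨Π_i f_i⟩(s)` uniform over the cube `[0,1]^I`, `|cornerSum (z univ ·) Γ| ≤ 2^{|Γ|−1}·B` — the corner sum of (5.14.3) on the full region
costs ONE `s`-derivative (a sum of trains from the bonds of `□_n`, p13 `dexp_singleton_walk`) and a factor `2^{|Γ|−1}`.
[cite: BalabanImbrieJaffe1988, (5.13.3) p.305; (5.14.3) p.309] -/
theorem abs_cornerSum_zG_univ_le {Γ : Finset I} {n : I} (hn : n ∈ Γ) {B : ℝ}
    (hB : ∀ s : I → ℝ, (∀ l, 0 ≤ s l ∧ s l ≤ 1) → |dexp blk Δ ℱ (fun ψ => ∏ i, f i ψ) {n} s| ≤ B) :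
    |cornerSum (zG blk Δ ℱ f (univ : Finset I)) Γ| ≤ 2 ^ (Γ.card - 1) * B := by
  have h := abs_cornerSum_corner_le_of_hasDerivAt_of_forall (g := BIJ88PolymerRep5134Gauss.expect blk Δ ℱ f (univ : Finset I))
    (g' := dexp blk Δ ℱ (fun ψ => ∏ i, f i ψ) {n}) hn
    (fun s hs => hasDerivAt_zG_univ_update blk ℱ hΔ hc hcΔ hCΔ hfm hK hs n) hB
  exact h

end LastCube

end Literature.MathematicalPhysics.QuantumFieldTheory.BalabanImbrieJaffe1984to88.BIJ88RegionLawUniv309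

end
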